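import Mathlib
import Summits.ValiantsHypothesis.ValiantsHypothesis.Theses.LiouvilleSarnak
import Literature.NumberTheory.LFunctions.LiouvilleNotAutomaticProofs
import HarnessLib

/-!
# Route LiouvilleSarnak — the aligned rung `AlignedCutRank` (stmt-ValiantsHypothesis-14776), PROVED

`AlignedCutRank`: for every `W` and all large `n`, the `2^n × 2^n` sign matrix
`M_n = (λ(a + 2^n b + 1))_{a,b < 2^n}` (`λ` = Liouville) has rank `≥ W`.

Proof (the refuter's crux-attack route, evidence `Proof.lean` on the item, re-derived here from the
tree): Coons 2010, Thm. 1.5 — `λ` is NOT `2`-automatic, i.e. its `2`-kernel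
`{b ↦ λ(2^l b + r) : l ≥ 0, 0 ≤ r < 2^l}` is INFINITE — is the tree's theorem
`Literature.NumberTheory.LFunctions.coons_liouville_not_automatic_holds`. Every kernel element
with `r ≥ 1` and level `l ≤ n` is, on the window `b < 2^n`, `±` a ROW of `M_n`: by complete
multiplicativity `λ(2^{n-l} x) = (-1)^{n-l} λ(x)`, and `2^{n-l}(2^l b + r) = 2^n b + 2^{n-l} r`
is the entry in row `a = 2^{n-l} r - 1`. The two kernel elements with `r = 0` are `±λ`. So an
infinite kernel gives, for every `K`, `K` kernel elements with `r ≥ 1`, pairwise distinct on a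
finite window, hence (signs being `±`, fibres of size `≤ 2`) at least `K/2` distinct rows of `M_n`
for every large `n`; and a `±1` matrix with `R` distinct rows has `R ≤ 2^{rank}` (a maximal
independent set of columns determines every column linearly, so a `±1` row is determined by its
`≤ rank` entries there).

Honest framing: the ALIGNED rung is a combinatorial consequence of non-automaticity; the route's
adversarial-cut crux `LiouvilleCutRank`, `DigitalBilinearLiouville` and `AlgebraicSarnak` stay OPEN
(they do not follow from this argument), and nothing here bears on VP versus VNP.

## References

* M. Coons, *(Non)automaticity of number theoretic functions*, J. Théor. Nombres Bordeaux 22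
  (2010) 339–352, Thm. 1.5. [cite: Coons2011, Theorem 1.5]
* J.-P. Allouche, J. Shallit, *Automatic Sequences*, CUP 2003, §6.6 (the `k`-kernel).
  [cite: AlloucheShallit2003, §6.6]
-/

set_option linter.dupNamespace false

noncomputable section

open Finset

namespace Summit.ValiantsHypothesis.ValiantsHypothesis.Theorems.LiouvilleSarnakAligned

/-! ### §1 A `±1` matrix with `R` distinct rows has `R ≤ 2^{rank}` -/

/-- **Distinct `±1` rows are few**: a matrix over a field all of whose entries are `1` or `-1`
(`1 ≠ -1`) has at most `2 ^ rank` distinct rows — a maximal linearly independent family of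
columns spans every column, so two rows agreeing on those `rank`-many columns agree everywhere.
[folklore] -/
theorem card_image_row_le_two_pow_rank {K : Type*} [Field K] [NeZero (2 : K)] {m n : Type*}
    [Fintype m] [Fintype n] [DecidableEq n] [DecidableEq K] (A : Matrix m n K)
    (hA : ∀ i j, A i j = 1 ∨ A i j = -1) :
    (Finset.univ.image fun i : m => A i).card ≤ 2 ^ A.rank := by
  classical
  -- a maximal independent family of columns
  obtain ⟨κ, c, hc_inj, hspan, hli⟩ := exists_linearIndependent' K (A.col : n → m → K)
  haveI : Finite κ := Finite.of_injective c hc_inj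
  letI : Fintype κ := Fintype.ofFinite κ
  have hcard : Fintype.card κ = A.rank := by
    rw [Matrix.rank_eq_finrank_span_cols, ← hspan, finrank_span_eq_card hli]
  -- rows agreeing on the chosen columns agree
  have hrows : ∀ i i' : m, (∀ k, A i (c k) = A i' (c k)) → A i = A i' := by
    intro i i' h
    let δ : (m → K) →ₗ[K] K :=
      (LinearMap.proj (R := K) (φ := fun _ : m => K) i) - LinearMap.proj (R := K) (φ := fun _ : m => K) i'
    have hker : Submodule.span K (Set.range (A.col ∘ c)) ≤ LinearMap.ker δ := by
      rw [Submodule.span_le]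
      rintro _ ⟨k, rfl⟩
      simp [δ, Matrix.col, h k]
    funext j
    have hj : A.col j ∈ Submodule.span K (Set.range (A.col ∘ c)) := by
      rw [hspan]; exact Submodule.subset_span ⟨j, rfl⟩
    have := hker hj
    simpa [δ, Matrix.col, sub_eq_zero] using this
  -- the sign pattern on the chosen columns is injective on rows
  let G : (n → K) → (κ → Bool) := fun x k => decide (x (c k) = 1)
  have hG : Set.InjOn G ↑(Finset.univ.image fun i : m => A i) := by
    rintro _ hx _ hy hxy
    simp only [Finset.coe_image, Finset.coe_univ, Set.image_univ, Set.mem_range] at hx hy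
    obtain ⟨i, rfl⟩ := hx
    obtain ⟨i', rfl⟩ := hy
    refine hrows i i' fun k => ?_
    have hk := congrFun hxy k
    simp only [G, decide_eq_decide] at hk
    have h2 : (1 : K) ≠ -1 := fun h => by
      have : (2 : K) = 0 := by
        calc (2 : K) = 1 + 1 := by norm_num
          _ = 1 + (-1) := by rw [← h]
          _ = 0 := by ring
      exact (NeZero.ne (2 : K)) this
    rcases hA i (c k) with h1 | h1 <;> rcases hA i' (c k) with h1' | h1'
    · rw [h1, h1']
    · exact absurd (hk.mp h1) (by rw [h1']; exact fun h => h2 h.symm)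
    · exact absurd (hk.mpr h1') (by rw [h1]; exact fun h => h2 h.symm)
    · rw [h1, h1']
  calc (Finset.univ.image fun i : m => A i).card
      ≤ (Finset.univ : Finset (κ → Bool)).card :=
        Finset.card_le_card_of_injOn G (fun _ _ => Finset.mem_coe.mpr (Finset.mem_univ _)) hG
    _ = 2 ^ A.rank := by
        rw [Finset.card_univ, Fintype.card_fun, Fintype.card_bool, hcard]

/-! ### §2 Liouville along dyadic dilations; kernel elements are `±` rows -/

open ArithmeticFunction in
/-- `λ(2^j x) = (-1)^j λ(x)` (complete multiplicativity, `λ(2) = -1`). [folklore] -/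
theorem liouville_two_pow_mul (j x : ℕ) :
    liouville (2 ^ j * x) = (-1) ^ j * liouville x := by
  induction j with
  | zero => simp
  | succ j ih =>
    rw [pow_succ, mul_comm (2 ^ j) 2, mul_assoc, liouville_apply_mul, ih,
      liouville_apply two_ne_zero, cardFactors_apply_prime Nat.prime_two, pow_succ]
    ring

open ArithmeticFunction in
/-- The entries of `M_n = (λ(a + 2^n b + 1))` are `±1`. [folklore] -/
theorem alignedMatrix_entry_eq_or (n : ℕ) (a b : Fin (2 ^ n)) :
    (Matrix.of fun a b : Fin (2 ^ n) =>
        (((liouville ((a : ℕ) + 2 ^ n * (b : ℕ) + 1) : ℤ) : ℂ))) a b = 1 ∨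
      (Matrix.of fun a b : Fin (2 ^ n) =>
        (((liouville ((a : ℕ) + 2 ^ n * (b : ℕ) + 1) : ℤ) : ℂ))) a b = -1 := by
  rw [Matrix.of_apply, liouville_apply (Nat.succ_ne_zero _)]
  rcases neg_one_pow_eq_or ℤ (cardFactors ((a : ℕ) + 2 ^ n * (b : ℕ) + 1)) with h | h
  · left; rw [h]; norm_num
  · right; rw [h]; norm_num

open ArithmeticFunction in
/-- **Kernel elements are `±` rows of `M_n`**: for `l ≤ n` and `1 ≤ r < 2^l`, the row
`a = 2^{n-l} r - 1` of `M_n` is `(-1)^{n-l} · (b ↦ λ(2^l b + r))` on `b < 2^n`, because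
`a + 2^n b + 1 = 2^{n-l} (2^l b + r)`. [cite: Coons2011, Theorem 1.5] -/
theorem exists_row_eq_sign_mul_kernel (n l r : ℕ) (hl : l ≤ n) (hr : 0 < r) (hrl : r < 2 ^ l) :
    ∃ (a : Fin (2 ^ n)) (ε : ℤ), (ε = 1 ∨ ε = -1) ∧ ∀ b : Fin (2 ^ n),
      (Matrix.of fun a b : Fin (2 ^ n) =>
          (((liouville ((a : ℕ) + 2 ^ n * (b : ℕ) + 1) : ℤ) : ℂ))) a b =
        (((ε * liouville (2 ^ l * (b : ℕ) + r) : ℤ) : ℂ)) := by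
  have hpow : 2 ^ (n - l) * 2 ^ l = 2 ^ n := by rw [← pow_add, Nat.sub_add_cancel hl]
  have hpos : 0 < 2 ^ (n - l) * r := Nat.mul_pos (Nat.two_pow_pos _) hr
  have hlt : 2 ^ (n - l) * r - 1 < 2 ^ n := by
    have : 2 ^ (n - l) * r ≤ 2 ^ n := by
      calc 2 ^ (n - l) * r ≤ 2 ^ (n - l) * 2 ^ l := Nat.mul_le_mul_left _ hrl.le
        _ = 2 ^ n := hpow
    omega
  refine ⟨⟨2 ^ (n - l) * r - 1, hlt⟩, (-1) ^ (n - l), neg_one_pow_eq_or ℤ _, fun b => ?_⟩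
  rw [Matrix.of_apply]
  have harg : (2 ^ (n - l) * r - 1 : ℕ) + 2 ^ n * (b : ℕ) + 1 = 2 ^ (n - l) * (2 ^ l * (b : ℕ) + r) := by
    rw [mul_add, ← mul_assoc, hpow]
    omega
  rw [harg, liouville_two_pow_mul]

/-! ### §3 The crux -/

open ArithmeticFunction Literature.NumberTheory.LFunctions in
/-- **Crux `AlignedCutRank` (stmt-ValiantsHypothesis-14776), PROVED**: for every `W` there is `n₀`
such that for all `n ≥ n₀` the aligned sign matrix `(λ(a + 2^n b + 1))_{a,b<2^n}` has rank `≥ W`.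
From Coons 2010 Thm. 1.5 (`coons_liouville_not_automatic_holds`: the `2`-kernel of `λ` is infinite),
§2 (kernel elements are `±` rows of `M_n`) and §1 (`R` distinct `±1` rows force `R ≤ 2^{rank}`).
[cite: Coons2011, Theorem 1.5] -/
theorem alignedCutRank_proof :
    Summit.ValiantsHypothesis.ValiantsHypothesis.Theses.LiouvilleSarnak.AlignedCutRank := by
  classical
  intro W
  -- Coons: the 2-kernel of λ is infinite
  have hinf : (kKernel 2 (fun n : ℕ => (liouville n : ℤ))).Infinite :=
    coons_liouville_not_automatic_holds 2 le_rfl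
  obtain ⟨F, hFsub, hFcard⟩ := hinf.exists_subset_card_eq (2 * 2 ^ W + 3)
  -- discard the two kernel elements `±λ` (those with residue `0`)
  set lam : ℕ → ℤ := fun n => liouville n with hlam
  set F' := F.filter (fun u => u ≠ lam ∧ u ≠ -lam) with hF'
  have hF'card : 2 * 2 ^ W + 1 ≤ F'.card := by
    have hsplit : F'.card + (F.filter (fun u => ¬ (u ≠ lam ∧ u ≠ -lam))).card = F.card := by
      rw [hF']
      exact Finset.card_filter_add_card_filter_not _
    have hsmall : (F.filter (fun u => ¬ (u ≠ lam ∧ u ≠ -lam))).card ≤ 2 := by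
      refine (Finset.card_le_card (t := {lam, -lam}) fun u hu => ?_).trans (Finset.card_le_two)
      rw [Finset.mem_filter] at hu
      rw [Finset.mem_insert, Finset.mem_singleton]
      by_cases h1 : u = lam
      · exact Or.inl h1
      · right
        by_contra h2
        exact hu.2 ⟨h1, h2⟩
    omega
  -- every remaining element is `b ↦ λ(2^l b + r)` with `r ≥ 1`
  have hrep : ∀ u ∈ F', ∃ l r : ℕ, 0 < r ∧ r < 2 ^ l ∧ u = fun b => liouville (2 ^ l * b + r) := by
    intro u hu
    rw [hF', Finset.mem_filter] at hu
    obtain ⟨huF, hne, hne'⟩ := hu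
    obtain ⟨l, r, hrl, rfl⟩ := hFsub huF
    refine ⟨l, r, Nat.pos_of_ne_zero fun hr0 => ?_, hrl, rfl⟩
    subst hr0
    rcases neg_one_pow_eq_or ℤ l with h | h
    · exact hne (funext fun b => by
        change liouville (2 ^ l * b + 0) = liouville b
        rw [add_zero, liouville_two_pow_mul, h, one_mul])
    · exact hne' (funext fun b => by
        change liouville (2 ^ l * b + 0) = -liouville b
        rw [add_zero, liouville_two_pow_mul, h, neg_one_mul])
  choose! lv rs hrs hrsl hu using hrep
  -- a finite window on which the elements of `F'` are pairwise distinct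
  have hwit : ∀ u ∈ F', ∀ v ∈ F', u ≠ v → ∃ b : ℕ, u b ≠ v b :=
    fun u _ v _ huv => Function.ne_iff.mp huv
  choose! wit hwit using hwit
  set B : ℕ := F'.sup (fun u => F'.sup (fun v => wit u v)) + 1 with hB
  set L : ℕ := F'.sup lv with hL
  refine ⟨max L B, fun n hn => ?_⟩
  set M : Matrix (Fin (2 ^ n)) (Fin (2 ^ n)) ℂ := Matrix.of fun a b : Fin (2 ^ n) =>
    (((liouville ((a : ℕ) + 2 ^ n * (b : ℕ) + 1) : ℤ) : ℂ)) with hM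
  have hnB : B ≤ 2 ^ n := ((le_max_right L B).trans hn).trans (Nat.lt_two_pow_self).le
  have hwit_lt : ∀ u ∈ F', ∀ v ∈ F', wit u v < 2 ^ n := by
    intro u hu v hv
    have h1 : wit u v ≤ F'.sup (fun v => wit u v) := Finset.le_sup (f := fun v => wit u v) hv
    have h2 : F'.sup (fun v => wit u v) ≤ F'.sup (fun u => F'.sup (fun v => wit u v)) :=
      Finset.le_sup (f := fun u => F'.sup (fun v => wit u v)) hu
    omega
  -- each element of `F'` is `±` a row of `M`
  have hrow : ∀ u ∈ F', ∃ (a : Fin (2 ^ n)) (ε : ℤ), (ε = 1 ∨ ε = -1) ∧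
      ∀ b : Fin (2 ^ n), M a b = (((ε * u b : ℤ)) : ℂ) := by
    intro u huF
    have hl : lv u ≤ n := ((Finset.le_sup (f := lv) huF).trans (le_max_left L B)).trans hn
    obtain ⟨a, ε, hε, hab⟩ := exists_row_eq_sign_mul_kernel n (lv u) (rs u) hl (hrs u huF) (hrsl u huF)
    refine ⟨a, ε, hε, fun b => ?_⟩
    have hub : u (b : ℕ) = liouville (2 ^ lv u * (b : ℕ) + rs u) := congrFun (hu u huF) b
    rw [hM, hab b, hub]
  choose! ra eps heps hMrow using hrow
  -- two distinct elements of `F'` with the same row have opposite signs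
  have hkey : ∀ u ∈ F', ∀ v ∈ F', u ≠ v → M (ra u) = M (ra v) → eps u ≠ eps v := by
    intro u hu v hv huv hMeq hε
    apply hwit u hu v hv huv
    have hb := hwit_lt u hu v hv
    have h1 := hMrow u hu ⟨wit u v, hb⟩
    have h2 := hMrow v hv ⟨wit u v, hb⟩
    rw [hMeq] at h1
    rw [h1, hε] at h2
    have h3 : eps v * u (wit u v) = eps v * v (wit u v) := by exact_mod_cast h2
    have hε0 : eps v ≠ 0 := by rcases heps v hv with h | h <;> simp [h]
    exact mul_left_cancel₀ hε0 h3
  -- hence the row map `u ↦ M (ra u)` has fibres of size ≤ 2 on `F'`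
  have hfib : ∀ x ∈ F'.image (fun u => M (ra u)), (F'.filter fun u => M (ra u) = x).card ≤ 2 := by
    intro x _
    by_contra h
    obtain ⟨u, hu, v, hv, w, hw, huv, huw, hvw⟩ := Finset.two_lt_card.mp (not_le.mp h)
    rw [Finset.mem_filter] at hu hv hw
    have e1 := hkey u hu.1 v hv.1 huv (hu.2.trans hv.2.symm)
    have e2 := hkey u hu.1 w hw.1 huw (hu.2.trans hw.2.symm)
    have e3 := hkey v hv.1 w hw.1 hvw (hv.2.trans hw.2.symm)
    rcases heps u hu.1 with a1 | a1 <;> rcases heps v hv.1 with a2 | a2 <;>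
      rcases heps w hw.1 with a3 | a3 <;>
      first
        | exact e1 (a1.trans a2.symm)
        | exact e2 (a1.trans a3.symm)
        | exact e3 (a2.trans a3.symm)
  have hcount := Finset.card_le_mul_card_image F' 2 hfib
  -- the image consists of rows of `M`
  have himg : (F'.image fun u => M (ra u)).card ≤ (Finset.univ.image fun a => M a).card :=
    Finset.card_le_card fun x hx => by
      obtain ⟨u, _, rfl⟩ := Finset.mem_image.mp hx
      exact Finset.mem_image_of_mem _ (Finset.mem_univ _)
  have hrank := card_image_row_le_two_pow_rank M (alignedMatrix_entry_eq_or n)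
  -- `2 · 2^W + 1 ≤ |F'| ≤ 2 · #rows ≤ 2 · 2^rank`
  have h2 : 2 ^ W < 2 ^ M.rank := by omega
  exact (Nat.pow_lt_pow_iff_right (by norm_num)).mp h2 |>.le

end Summit.ValiantsHypothesis.ValiantsHypothesis.Theorems.LiouvilleSarnakAligned

end
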